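import Literature.Analysis.FluidPDE.Tao2016AveragedNS.SplitCascadeRescaledWindow
import Literature.Analysis.FluidPDE.Tao2016AveragedNS.SplitCascadeRescaledEnergy
import Literature.Analysis.FluidPDE.TaoCascadeDrainEnergy
import HarnessLib

/-!
# The split Prop. 6.5, §6.7: the drain estimate (6.174)/(6.184)–(6.186) (port of `TaoCascadeDrainEnergy`)

T. Tao, *Finite time blowup for an averaged three-dimensional Navier–Stokes equation*,
J. Amer. Math. Soc. 29 (2016), 601–674 = arXiv:1402.0290v3, §6.7 (6.174), (6.184)–(6.186).
HONEST FRAMING: statements about the SPLIT cascade model system; nothing here proves the split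
Prop. 6.5 and nothing here concerns the true Navier–Stokes equations.

Split counterpart of `TaoCascadeDrainEnergy.lean` (`drain_bound` under `RescaledSplitHypotheses`):
hypotheses with `C₁/2`, window certificate `hw : AsymWindow ε₀ K ε C₁ n₀ W T ζ`, sub-window
`[s₁, T'] ⊆ [0, T]`; statement and proof otherwise the tree's (abstract modified-energy lemmas of
`TaoCascadeZeroScaleDrain.lean` reused).

## References

* T. Tao, J. Amer. Math. Soc. 29 (2016), 601–674 = arXiv:1402.0290v3, §6.7 (6.174), (6.184)–(6.186).
  [`Tao2016AveragedNS`]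
-/

noncomputable section

open Set MeasureTheory intervalIntegral Filter Topology

namespace Literature.Analysis.FluidPDE

namespace Tao2016AveragedNS

open TaoCascade Literature.Analysis.ODE

section DrainEnergy

variable {γ ε₀ K ε C₁ C₂ C₃ : ℝ} {n₀ N : ℤ} {ηp : ℤ → ℝ} {βp : ℕ → ℝ} {τ : ℤ → ℝ}
  {Xr : Fin 4 → ℤ → ℝ → ℝ} {Wz : Fin 3 → ℤ → ℝ → ℝ} {Er : ℤ → ℝ → ℝ} {T ζ : ℝ}

/-- **The drain estimate (6.184)–(6.186)/(6.174) with explicit levels.** On `[s₁, T']`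
(`0 ≤ s₁ ≤ T'`) assume `Ẽ₀, Ẽ₁ ≤ 1`, `Ẽ₋₁ ≤ E₋`, `|b₁| ≤ B_b`, `|c₁| ≤ B_c`, `|d₁| ≤ B_d`,
`c₀ ≥ c_min > 0`, `|b₀| ≤ b_max`, `a₁ ≥ α₁ > 0`. With `ρ = ε⁻²`, `κ = (1+ε₀)^{5/2}K`, `M = √2`,
`w₁ = 1/(ρc_min)`, `η = C₁(1+ε₀)^{-n₀/2}`, `η₁ = 2ε + 2ε²e^{-K^{10}} + 2KE₋ + η`,
`ν = (1+ε₀)^{5/2}(εB_b + ε²e^{-K^{10}}B_c)`, `η₃ = (1+ε₀)^{5/2}ε⁻²B_cB_d + C₁(1+ε₀)^{2-n₀/2}`,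
`L = ε⁻¹K^{10}b_max + (ε²e^{-K^{10}}M² + η)/c_min`,
`Θ = ½κw₁((η₁ + η)M² + M²(κM² + νM + η₃) + M³L)`, `ν₀ = ½κM³w₁`, `β = κα₁/2`, `α = (η₁ + η)/√2`,
`θ = (κMν₀ + Θ)/2`: for `t ∈ [s₁, T']`,
`a₀(t)² + d₀(t)² ≤ 2(e^{-β(t-s₁)}√(Ẽ₀(s₁) + 2ν₀) + α/β + 3√(θ/β))²`.
[cite: Tao2016AveragedNS, §6.7 (6.174), (6.184)–(6.186)] -/
theorem RescaledSplitHypotheses.drain_bound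
    (h : RescaledSplitHypotheses γ ε₀ K ε (C₁ / 2) C₂ C₃ n₀ N ηp βp τ Xr Wz Er)
    (hw : AsymWindow ε₀ K ε C₁ n₀ Wz T ζ) (hε : 0 < ε) (hε1 : ε ≤ 1) (hK : 0 < K) (hK1 : 1 ≤ K)
    (hC₁ : 0 ≤ C₁) (hε₀ : 0 < ε₀) (hε₀1 : ε₀ < 1) (hN : n₀ ≤ N) {s₁ T' Em Bb Bc Bd cmin bmax α₁ : ℝ}
    (hs₁ : 0 ≤ s₁) (hsT : s₁ ≤ T') (hT' : T' ≤ T) (hcmin : 0 < cmin) (hα₁ : 0 < α₁)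
    (hreg : ∀ t ∈ Icc s₁ T', Er 0 t ≤ 1 ∧ Er 1 t ≤ 1 ∧ Er (-1) t ≤ Em)
    (hsec : ∀ t ∈ Icc s₁ T', |Xr 1 1 t| ≤ Bb ∧ |Xr 2 1 t| ≤ Bc ∧ |Xr 3 1 t| ≤ Bd)
    (hc : ∀ t ∈ Icc s₁ T', cmin ≤ Xr 2 0 t) (hb : ∀ t ∈ Icc s₁ T', |Xr 1 0 t| ≤ bmax)
    (ha₁ : ∀ t ∈ Icc s₁ T', α₁ ≤ Xr 0 1 t) {t : ℝ} (ht : t ∈ Icc s₁ T') :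
    let ρ : ℝ := (ε ^ 2)⁻¹
    let κ : ℝ := (1 + ε₀) ^ ((5 : ℝ) / 2) * K
    let M : ℝ := Real.sqrt 2
    let w₁ : ℝ := 1 / (ρ * cmin)
    let η : ℝ := C₁ * (1 + ε₀) ^ (-((n₀ : ℝ) / 2))
    let η₁ : ℝ := 2 * ε + 2 * ε ^ 2 * Real.exp (-K ^ 10) + 2 * K * Em + η
    let ν : ℝ := (1 + ε₀) ^ ((5 : ℝ) / 2) * (ε * Bb + ε ^ 2 * Real.exp (-K ^ 10) * Bc)
    let η₃ : ℝ := (1 + ε₀) ^ ((5 : ℝ) / 2) * (ε ^ 2)⁻¹ * Bc * Bd + C₁ * (1 + ε₀) ^ (2 - (n₀ : ℝ) / 2)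
    let L : ℝ := ε⁻¹ * K ^ 10 * bmax + (ε ^ 2 * Real.exp (-K ^ 10) * M ^ 2 + η) / cmin
    let Θ : ℝ := 1 / 2 * κ * w₁ * ((η₁ + η) * M ^ 2 + M ^ 2 * (κ * M ^ 2 + ν * M + η₃) + M ^ 3 * L)
    let ν₀ : ℝ := 1 / 2 * κ * M ^ 3 * w₁
    let β : ℝ := κ * α₁ / 2
    let α : ℝ := (η₁ + η) / Real.sqrt 2
    let θ : ℝ := (κ * M * ν₀ + Θ) / 2
    Xr 0 0 t ^ 2 + Xr 3 0 t ^ 2 ≤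
      2 * (Real.exp (-β * (t - s₁)) * Real.sqrt (Er 0 s₁ + 2 * ν₀) + α / β +
        3 * Real.sqrt (θ / β)) ^ 2 := by
  intro ρ κ M w₁ η η₁ ν η₃ L Θ ν₀ β α θ
  have hρ_def : ρ = (ε ^ 2)⁻¹ := rfl
  have hκ_def : κ = (1 + ε₀) ^ ((5 : ℝ) / 2) * K := rfl
  have hM_def : M = Real.sqrt 2 := rfl
  have hw₁_def : w₁ = 1 / (ρ * cmin) := rfl
  have hη_def : η = C₁ * (1 + ε₀) ^ (-((n₀ : ℝ) / 2)) := rfl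
  have hη₁_def : η₁ = 2 * ε + 2 * ε ^ 2 * Real.exp (-K ^ 10) + 2 * K * Em + η := rfl
  have hν_def : ν = (1 + ε₀) ^ ((5 : ℝ) / 2) * (ε * Bb + ε ^ 2 * Real.exp (-K ^ 10) * Bc) := rfl
  have hη₃_def : η₃ = (1 + ε₀) ^ ((5 : ℝ) / 2) * (ε ^ 2)⁻¹ * Bc * Bd +
      C₁ * (1 + ε₀) ^ (2 - (n₀ : ℝ) / 2) := rfl
  have hL_def : L = ε⁻¹ * K ^ 10 * bmax + (ε ^ 2 * Real.exp (-K ^ 10) * M ^ 2 + η) / cmin := rfl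
  have hΘ_def : Θ = 1 / 2 * κ * w₁ * ((η₁ + η) * M ^ 2 + M ^ 2 * (κ * M ^ 2 + ν * M + η₃) +
      M ^ 3 * L) := rfl
  have hν₀_def : ν₀ = 1 / 2 * κ * M ^ 3 * w₁ := rfl
  have hβ_def : β = κ * α₁ / 2 := rfl
  have hα_def : α = (η₁ + η) / Real.sqrt 2 := rfl
  have hθ_def : θ = (κ * M * ν₀ + Θ) / 2 := rfl
  have hτ0 : τ (n₀ - N) ≤ 0 := h.tau_init_le hN
  have hτs : τ (n₀ - N) ≤ s₁ := hτ0.trans hs₁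
  have hq0 : (0 : ℝ) < 1 + ε₀ := by linarith
  have hs₁m : s₁ ∈ Icc s₁ T' := ⟨le_rfl, hsT⟩
  have hEm : 0 ≤ Em := (h.nonneg_F (-1) s₁ hτs).trans (hreg s₁ hs₁m).2.2
  have hBb : 0 ≤ Bb := (abs_nonneg _).trans (hsec s₁ hs₁m).1
  have hBc : 0 ≤ Bc := (abs_nonneg _).trans (hsec s₁ hs₁m).2.1
  have hBd : 0 ≤ Bd := (abs_nonneg _).trans (hsec s₁ hs₁m).2.2
  have hbmax : 0 ≤ bmax := (abs_nonneg _).trans (hb s₁ hs₁m)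
  have hρ : 0 < ρ := by rw [hρ_def]; positivity
  have hκ : 0 < κ := by rw [hκ_def]; positivity
  have hM : 0 < M := by rw [hM_def]; positivity
  have hM2 : M ^ 2 = 2 := by rw [hM_def]; exact Real.sq_sqrt (by norm_num)
  have hw₁ : 0 < w₁ := by rw [hw₁_def]; positivity
  have hη : 0 ≤ η := by rw [hη_def]; positivity
  have hη₁ : 0 ≤ η₁ := by rw [hη₁_def]; positivity
  have hν : 0 ≤ ν := by rw [hν_def]; positivity
  have hη₃ : 0 ≤ η₃ := by rw [hη₃_def]; positivity
  have hL : 0 ≤ L := by rw [hL_def]; positivity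
  have hΘ : 0 ≤ Θ := by rw [hΘ_def]; positivity
  have hν₀ : 0 < ν₀ := by rw [hν₀_def]; positivity
  have hβ : 0 < β := by rw [hβ_def]; positivity
  have hα : 0 ≤ α := by rw [hα_def]; positivity
  have hθ : 0 < θ := by rw [hθ_def]; positivity
  clear_value ρ κ M w₁ η η₁ ν η₃ L Θ ν₀ β α θ
  have hCpos : ∀ u ∈ Icc s₁ T', 0 < Xr 2 0 u := fun u hu => hcmin.trans_le (hc u hu)
  -- the modified energy `E_*` and `W = E_* + ν₀`
  set Es : ℝ → ℝ := fun u => (1 / 2) * (Xr 0 0 u ^ 2 + Xr 3 0 u ^ 2) -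
    (1 / 2) * κ * (Xr 0 0 u * Xr 3 0 u * Xr 0 1 u / (ρ * Xr 2 0 u)) with hEs
  set W : ℝ → ℝ := fun u => Es u + ν₀ with hW
  -- size of the modes
  have haM : ∀ u ∈ Icc s₁ T', |Xr 0 0 u| ≤ M := fun u hu => by
    rw [hM_def]
    exact (h.abs_le_sqrt_energy 0 0 (hτs.trans hu.1)).trans
      (Real.sqrt_le_sqrt (by linarith [(hreg u hu).1]))
  have hdM : ∀ u ∈ Icc s₁ T', |Xr 3 0 u| ≤ M := fun u hu => by
    rw [hM_def]
    exact (h.abs_le_sqrt_energy 3 0 (hτs.trans hu.1)).trans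
      (Real.sqrt_le_sqrt (by linarith [(hreg u hu).1]))
  have h1M : ∀ u ∈ Icc s₁ T', |Xr 0 1 u| ≤ M := fun u hu => by
    rw [hM_def]
    exact (h.abs_le_sqrt_energy 0 1 (hτs.trans hu.1)).trans
      (Real.sqrt_le_sqrt (by linarith [(hreg u hu).2.1]))
  -- `|½κ corr| ≤ ν₀`
  have hcorr_le : ∀ u ∈ Icc s₁ T',
      |(1 / 2) * κ * (Xr 0 0 u * Xr 3 0 u * Xr 0 1 u / (ρ * Xr 2 0 u))| ≤ ν₀ := by
    intro u hu
    have hCu := hCpos u hu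
    have hw : 1 / (ρ * Xr 2 0 u) ≤ w₁ := by
      rw [hw₁_def]
      exact one_div_le_one_div_of_le (by positivity) (mul_le_mul_of_nonneg_left (hc u hu) hρ.le)
    have hnum : |Xr 0 0 u| * |Xr 3 0 u| * |Xr 0 1 u| ≤ M * M * M :=
      mul_le_mul (mul_le_mul (haM u hu) (hdM u hu) (abs_nonneg _) hM.le) (h1M u hu) (abs_nonneg _)
        (by positivity)
    have h1 : |Xr 0 0 u * Xr 3 0 u * Xr 0 1 u / (ρ * Xr 2 0 u)| ≤ M ^ 3 * w₁ := by
      rw [abs_div, abs_mul, abs_mul, abs_of_pos (by positivity : 0 < ρ * Xr 2 0 u),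
        div_eq_mul_one_div]
      calc |Xr 0 0 u| * |Xr 3 0 u| * |Xr 0 1 u| * (1 / (ρ * Xr 2 0 u)) ≤ M * M * M * w₁ :=
            mul_le_mul hnum hw (by positivity) (by positivity)
        _ = M ^ 3 * w₁ := by ring
    rw [abs_mul, abs_of_nonneg (by positivity : (0 : ℝ) ≤ 1 / 2 * κ), hν₀_def]
    calc 1 / 2 * κ * |Xr 0 0 u * Xr 3 0 u * Xr 0 1 u / (ρ * Xr 2 0 u)| ≤ 1 / 2 * κ * (M ^ 3 * w₁) :=
          mul_le_mul_of_nonneg_left h1 (by positivity)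
      _ = 1 / 2 * κ * M ^ 3 * w₁ := by ring
  -- `W ≥ 0` and `a₀² + d₀² ≤ 2W`
  have hPW : ∀ u ∈ Icc s₁ T', Xr 0 0 u ^ 2 + Xr 3 0 u ^ 2 ≤ 2 * W u ∧ 0 ≤ W u := by
    intro u hu
    have h1 := (abs_le.mp (hcorr_le u hu)).2
    have hWu : W u = (1 / 2) * (Xr 0 0 u ^ 2 + Xr 3 0 u ^ 2) -
        (1 / 2) * κ * (Xr 0 0 u * Xr 3 0 u * Xr 0 1 u / (ρ * Xr 2 0 u)) + ν₀ := rfl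
    rw [hWu]
    constructor
    · linarith only [h1]
    · nlinarith only [h1, sq_nonneg (Xr 0 0 u), sq_nonneg (Xr 3 0 u)]
  -- derivative of `W` and the supersolution inequality
  have hderiv : ∀ u ∈ Ico s₁ T', ∃ e' : ℝ, HasDerivWithinAt W e' (Ici u) u ∧
      e' ≤ -2 * (κ * α₁ / 2) * W u + 2 * ((η₁ + η) / Real.sqrt 2) * Real.sqrt (W u) +
        2 * ((κ * M * ν₀ + Θ) / 2) := by
    intro u hu
    have hu' : u ∈ Icc s₁ T' := Ico_subset_Icc_self hu
    have hτu : τ (n₀ - N) ≤ u := hτs.trans hu.1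
    have hCu := hCpos u hu'
    have hρC : ρ * Xr 2 0 u ≠ 0 := (mul_pos hρ hCu).ne'
    have hmd := modifiedEnergy_hasDerivWithinAt (ρ := ρ) (κ := κ) (h.contDiffOn_Y 0 0)
      (h.contDiffOn_Y 3 0) (h.contDiffOn_Y 2 0) (h.contDiffOn_Y 0 1) hτu hρC
    refine ⟨_, hmd.add_const ν₀, ?_⟩
    have hregu := hreg u hu'
    have hsecu := hsec u hu'
    have huT : u ∈ Icc 0 T := ⟨hs₁.trans hu'.1, hu'.2.trans hT'⟩
    have hτ0 : τ (n₀ - N) ≤ 0 := h.tau_init_le hN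
    have he₁ := h.eq_a_zero' hw hτ0 hε hε1 hK1 hC₁ hε₀ huT hregu.1 hregu.2.2
    have he₄ := h.eq_d_zero' hw hτ0 hε hε1 hK1 hC₁ hε₀ huT hregu.1
    have he₅ := h.eq_a_one' hw hτ0 hε hε1 hK1 hC₁ hε₀ hε₀1 huT hregu.2.1 hsecu.1 hsecu.2.1 hsecu.2.2
    have hec := h.eq_c_zero' hw hτ0 hε hε1 hK1 hC₁ hε₀ huT hregu.1
    -- `|c₀'| ≤ L c₀`
    have hcL : |derivWithin (Xr 2 0) (Ici (τ (n₀ - N))) u| ≤ L * Xr 2 0 u := by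
      have hbu := hb u hu'
      have hau := haM u hu'
      have hsrc : ε ^ 2 * Real.exp (-K ^ 10) * Xr 0 0 u ^ 2 ≤ ε ^ 2 * Real.exp (-K ^ 10) * M ^ 2 := by
        refine mul_le_mul_of_nonneg_left ?_ (by positivity)
        rw [← sq_abs]; exact pow_le_pow_left₀ (abs_nonneg _) hau 2
      have hrot : |ε⁻¹ * K ^ 10 * Xr 1 0 u * Xr 2 0 u| ≤ ε⁻¹ * K ^ 10 * bmax * Xr 2 0 u := by
        rw [abs_mul, abs_mul, abs_of_pos hCu, abs_of_nonneg (by positivity : (0 : ℝ) ≤ ε⁻¹ * K ^ 10)]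
        exact mul_le_mul_of_nonneg_right (mul_le_mul_of_nonneg_left hbu (by positivity)) hCu.le
      have htri : |derivWithin (Xr 2 0) (Ici (τ (n₀ - N))) u| ≤
          η + ε ^ 2 * Real.exp (-K ^ 10) * Xr 0 0 u ^ 2 + |ε⁻¹ * K ^ 10 * Xr 1 0 u * Xr 2 0 u| := by
        have h1 := abs_le.mp hec
        have h2 := le_abs_self (ε⁻¹ * K ^ 10 * Xr 1 0 u * Xr 2 0 u)
        have h3 := neg_abs_le (ε⁻¹ * K ^ 10 * Xr 1 0 u * Xr 2 0 u)
        have h4 : 0 ≤ ε ^ 2 * Real.exp (-K ^ 10) * Xr 0 0 u ^ 2 := by positivity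
        rw [hη_def]
        rw [abs_le]; constructor <;> linarith only [h1.1, h1.2, h2, h3, h4]
      have hconst : η + ε ^ 2 * Real.exp (-K ^ 10) * M ^ 2 ≤
          (ε ^ 2 * Real.exp (-K ^ 10) * M ^ 2 + η) / cmin * Xr 2 0 u := by
        rw [div_mul_eq_mul_div, le_div_iff₀ hcmin]
        have := mul_le_mul_of_nonneg_left (hc u hu')
          (show 0 ≤ ε ^ 2 * Real.exp (-K ^ 10) * M ^ 2 + η by positivity)
        linarith only [this]
      rw [hL_def]
      have : (ε⁻¹ * K ^ 10 * bmax + (ε ^ 2 * Real.exp (-K ^ 10) * M ^ 2 + η) / cmin) * Xr 2 0 u =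
          ε⁻¹ * K ^ 10 * bmax * Xr 2 0 u + (ε ^ 2 * Real.exp (-K ^ 10) * M ^ 2 + η) / cmin * Xr 2 0 u := by
        ring
      rw [this]
      linarith only [htri, hsrc, hrot, hconst]
    have hw : 1 / (ρ * Xr 2 0 u) ≤ w₁ := by
      rw [hw₁_def]
      exact one_div_le_one_div_of_le (by positivity) (mul_le_mul_of_nonneg_left (hc u hu') hρ.le)
    have he₁' : |derivWithin (Xr 0 0) (Ici (τ (n₀ - N))) u + ρ * Xr 2 0 u * Xr 3 0 u| ≤ η₁ := by
      rw [hη₁_def, hη_def, hρ_def]; exact he₁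
    have he₄' : |derivWithin (Xr 3 0) (Ici (τ (n₀ - N))) u -
        (ρ * Xr 2 0 u * Xr 0 0 u - κ * Xr 3 0 u * Xr 0 1 u)| ≤ η := by
      rw [hη_def, hρ_def, hκ_def]; exact he₄
    have he₅' : |derivWithin (Xr 0 1) (Ici (τ (n₀ - N))) u - κ * Xr 3 0 u ^ 2| ≤
        ν * |Xr 0 1 u| + η₃ := by
      rw [hν_def, hη₃_def, hκ_def]; exact he₅
    have halg := modifiedEnergy_algebra (ρ := ρ) (κ := κ) (A := Xr 0 0 u) (Dd := Xr 3 0 u)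
      (B := Xr 0 1 u) (C := Xr 2 0 u)
      (A' := derivWithin (Xr 0 0) (Ici (τ (n₀ - N))) u)
      (D' := derivWithin (Xr 3 0) (Ici (τ (n₀ - N))) u)
      (B' := derivWithin (Xr 0 1) (Ici (τ (n₀ - N))) u)
      (C' := derivWithin (Xr 2 0) (Ici (τ (n₀ - N))) u)
      hρ hκ.le hν hη₃ hCu hw hcL (haM u hu') (hdM u hu') (h1M u hu') he₁' he₄' he₅'
    -- the supersolution algebra
    obtain ⟨hP2, hW0⟩ := hPW u hu'
    have ha1M : Xr 0 1 u ≤ M := (le_abs_self _).trans (h1M u hu')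
    have hΘ' : (1 / 2) * κ * w₁ * ((η₁ + η) * M ^ 2 + M ^ 2 * (κ * M ^ 2 + ν * M + η₃) + M ^ 3 * L) = Θ := by
      rw [hΘ_def]
    have hEsu : Es u = (1 / 2) * (Xr 0 0 u ^ 2 + Xr 3 0 u ^ 2) -
        (1 / 2) * κ * (Xr 0 0 u * Xr 3 0 u * Xr 0 1 u / (ρ * Xr 2 0 u)) := rfl
    have hD : (Xr 0 0 u * derivWithin (Xr 0 0) (Ici (τ (n₀ - N))) u +
          Xr 3 0 u * derivWithin (Xr 3 0) (Ici (τ (n₀ - N))) u) -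
        (1 / 2) * κ *
          ((((derivWithin (Xr 0 0) (Ici (τ (n₀ - N))) u * Xr 3 0 u +
                  Xr 0 0 u * derivWithin (Xr 3 0) (Ici (τ (n₀ - N))) u) * Xr 0 1 u +
                Xr 0 0 u * Xr 3 0 u * derivWithin (Xr 0 1) (Ici (τ (n₀ - N))) u) * (ρ * Xr 2 0 u) -
              Xr 0 0 u * Xr 3 0 u * Xr 0 1 u * (ρ * derivWithin (Xr 2 0) (Ici (τ (n₀ - N))) u)) /
            (ρ * Xr 2 0 u) ^ 2) ≤
        -κ * Xr 0 1 u * Es u + (η₁ + η) * Real.sqrt (Xr 0 0 u ^ 2 + Xr 3 0 u ^ 2) + Θ := by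
      rw [hEsu, ← hΘ']
      exact halg
    have hsup := drain_supersolution_algebra (W := W u) (E := Es u) (P := Xr 0 0 u ^ 2 + Xr 3 0 u ^ 2)
      (a := Xr 0 1 u) (κ := κ) (α₁ := α₁) (M := M) (η := η₁ + η) (Θ := Θ) (ν₀ := ν₀) rfl hW0 hν₀.le
      hP2 (ha₁ u hu') ha1M hκ.le (by positivity) hD
    exact hsup
  -- continuity of `W`
  have hW_cont : ContinuousOn W (Icc s₁ T') := by
    have hca := h.continuousOn_X 0 0 hτs (b := T')
    have hcd := h.continuousOn_X 3 0 hτs (b := T')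
    have hcc := h.continuousOn_X 2 0 hτs (b := T')
    have hc1 := h.continuousOn_X 0 1 hτs (b := T')
    have hcorr_c : ContinuousOn (fun u => Xr 0 0 u * Xr 3 0 u * Xr 0 1 u / (ρ * Xr 2 0 u))
        (Icc s₁ T') :=
      ((hca.mul hcd).mul hc1).div (continuousOn_const.mul hcc) fun u hu => (mul_pos hρ (hCpos u hu)).ne'
    have hEs_c : ContinuousOn Es (Icc s₁ T') :=
      (continuousOn_const.mul ((hca.pow 2).add (hcd.pow 2))).sub (continuousOn_const.mul hcorr_c)
    exact hEs_c.add continuousOn_const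
  -- the decay lemma
  choose! e' he' using hderiv
  have hdec := sqrt_decay_of_deriv_right_le (W := W) (W' := e') (α := (η₁ + η) / Real.sqrt 2)
    (β := κ * α₁ / 2) (θ := (κ * M * ν₀ + Θ) / 2) hW_cont (fun u hu => (he' u hu).1)
    (fun u hu => (hPW u hu).2) (by positivity) (by positivity) (by positivity)
    (fun u hu => (he' u hu).2) ht
  -- unwind
  have hWs : W s₁ ≤ Er 0 s₁ + 2 * ν₀ := by
    have h1 := (abs_le.mp (hcorr_le s₁ hs₁m)).1
    have h2 := h.defect_lower 0 s₁ hτs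
    have hZnn : 0 ≤ ∑ i, Wz i 0 s₁ ^ 2 := Finset.sum_nonneg fun i _ => sq_nonneg _
    rw [Fin.sum_univ_four] at h2
    have hWu : W s₁ = (1 / 2) * (Xr 0 0 s₁ ^ 2 + Xr 3 0 s₁ ^ 2) -
        (1 / 2) * κ * (Xr 0 0 s₁ * Xr 3 0 s₁ * Xr 0 1 s₁ / (ρ * Xr 2 0 s₁)) + ν₀ := rfl
    rw [hWu]
    nlinarith only [h1, h2, hZnn, sq_nonneg (Xr 1 0 s₁), sq_nonneg (Xr 2 0 s₁)]
  have hsqrtWs : Real.sqrt (W s₁) ≤ Real.sqrt (Er 0 s₁ + 2 * ν₀) := Real.sqrt_le_sqrt hWs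
  have hR0 : 0 ≤ Real.exp (-(κ * α₁ / 2) * (t - s₁)) * Real.sqrt (W s₁) +
      (η₁ + η) / Real.sqrt 2 / (κ * α₁ / 2) + 3 * Real.sqrt ((κ * M * ν₀ + Θ) / 2 / (κ * α₁ / 2)) := by
    positivity
  have hle : Real.sqrt (W t) ≤ Real.exp (-β * (t - s₁)) * Real.sqrt (Er 0 s₁ + 2 * ν₀) + α / β +
      3 * Real.sqrt (θ / β) := by
    rw [hβ_def, hα_def, hθ_def]
    refine hdec.trans ?_
    have := mul_le_mul_of_nonneg_left hsqrtWs (Real.exp_pos (-(κ * α₁ / 2) * (t - s₁))).le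
    linarith only [this]
  have hWt := (hPW t ht)
  have hsq : W t = Real.sqrt (W t) ^ 2 := (Real.sq_sqrt hWt.2).symm
  have h0 : 0 ≤ Real.sqrt (W t) := Real.sqrt_nonneg _
  calc Xr 0 0 t ^ 2 + Xr 3 0 t ^ 2 ≤ 2 * W t := hWt.1
    _ = 2 * Real.sqrt (W t) ^ 2 := by rw [← hsq]
    _ ≤ 2 * (Real.exp (-β * (t - s₁)) * Real.sqrt (Er 0 s₁ + 2 * ν₀) + α / β +
        3 * Real.sqrt (θ / β)) ^ 2 := by
        have := pow_le_pow_left₀ h0 hle 2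
        linarith only [this]

end DrainEnergy

end Tao2016AveragedNS

end Literature.Analysis.FluidPDE
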